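import Literature.IUT.HodgeTheaters.GenuineFKitOfBadLocalClosedPairNV
import Literature.IUT.HodgeTheaters.GenuineFKitOfBadLocalNVSlotsDelta
import Literature.IUT.HodgeTheaters.BadLocalGroupDatumDeltaCharacteristic
import HarnessLib

/-!
# R64 «EX32VI-AB@CLOSED-H»: [IUTchI] Example 3.2 (vi)(a)(b)(c) AT EVERY CLOSED BAD-PAIR FAMILY — the anabelian binder `hΔ`
# ([AbsAnab] Lemma 1.3.8 shape) at `m2OfClosed B x hx hH` in FACT currency (F-0001 regime), and agreement with the stand-in (proofs only)

S. Mochizuki, *Inter-universal Teichmüller theory I*, kurims manuscript (May 2020), Example 3.2 (vi) p. 73 («(a) … reconstructing the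
subcategory `𝒟⊢_v ⊆ 𝒟_v` from the category `𝒟_v` [cf. [AbsAnab], Lemma 1.3.8]; (b) … `𝒟^Θ_v` from `𝒟_v`; (c) … `𝒟⊢_v` (respectively, `𝒟^Θ_v`)
from `𝒞⊢_v` (respectively, `𝒞^Θ_v`)»), Definition 3.1 (e)(f) pp. 62–63 ([IUTchI] Ex 3.2 (vi) p.73) [claim: Mochizuki2012, status: disputed]
(D-0012 claim key, series status DISPUTED — compositions BY NAME over landed files; nothing of the series is asserted; no side is taken on
[IUTchIII] Cor. 3.12); [AbsAnab] Lemma 1.3.8 p. 18 [cite: MochizukiAbsAnab2004, Lemma 1.3.8 p.18]; [AbsTopI] Thm 2.6 (v) p. 22 («the kernel of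
`Π ↠ G` may be characterized group-theoretically») [cite: MochizukiAbsTopI2012, Thm 2.6 (v) p.22]; [SemiAnbd] §6 p. 69 [cite: MochizukiSemiAnbd2006, §6 p.69].

PURPOSE — abc-iut-L5-lead RULINGS #127 (3), row R64 (keyed abc-iut-L5-t2 g10): «transport `ex32vi_abc_frobeniusBadAt_standIn_of_coinvariantRank`
(★ p503880) from the stand-in to `m2OfClosed B x hx hH` (abc-iut-w4-d077 ★ p503701) for EVERY closed `H` with tfg `Δ_H`, side conditions in
FACT currency only; agreement lemma at the stand-in BY NAME».  THIS PROOF-ONLY FILE (no `def`, no `instance`, no named fact):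
* `hY_m2OfClosed` — the (vi)(b) binder is TRIVIAL at `m2OfClosed` (`Π_Ÿ := Π_v̲`, conjugator `1`);
* `exists_fundamentalExtension_m2OfClosed` — NON-VACUITY of the packaging: for every bad-pair family `B` and bad index `x` with
  `H := (B x hx).H` CLOSED in `Π_{C_F}` (hence profinite), `H ↠ Gal(K̄_v̲/K_v̲)` (the canonical `augOfOver`) IS an abc-iut-L4 `FundamentalExtension`
  WITH MLF base data `(p_v̲, K_v̲ = RescaledCompletion K p_v̲ w_v̲, id)`, `e = id`, `e(Δ_{Ev}) = Ker(aug)` (`GalAt x = Gal(K̄_v̲/K_v̲)` is `rfl`-Mathlib's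
  `absoluteGaloisGroup`);
* `forall_map_ker_m2OfClosed_aug_of_preservesGeom` (F-0007 `PreservesGeom` BY NAME on any packaging), `…_of_coinvariantRank` (F-0001
  `CoinvariantRankConstant` IN UNFOLDED SHAPE at `H` itself + `Δ_H := Ker(H ↠ Gal(K̄_v̲/K_v̲))` topologically finitely generated — [AbsTopI] Thm
  2.6 (v), kernel theorem `preservesGeom_of_coinvariantRankConstant`), `…_of_regime` (the regime BY NAME on every packaging),
  `…_of_completionRegime` (the same in the profinite-completion currency of `BadLocalGroupDatumDeltaCharacteristic`, packages EXIST);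
* `isTopologicallyFinitelyGenerated_ker_m2StandIn_aug` / `…_ker_m2OfClosed_aug_badPairAtArrow` — at the stand-in family the side condition
  «`Δ_H` tfg» is a THEOREM under F-0240 (the record's `hTFG`): `Δ_v̲ ≅ Π_{X̲→_K} ∩ Δ_C` is open in the tfg `Δ_C` (abc-iut-L5-t16
  `isTopologicallyFinitelyGenerated_ker_augLoc`, transported along `standInEquiv`; agreement `m2OfClosed_badPairAtArrow_eq_m2StandIn` BY NAME);
* cone read-outs for EVERY merge record `I` whose (m2) at `x` IS `m2OfClosed B x hx hH`:
  `ex32vi_abc_frobeniusBadAt_of_isClosed_of_coinvariantRank` / `_of_regime` / `_of_preservesGeom` — **(a) ∧ (b) ∧ (c) at `frobeniusBadAt B I x hx`**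
  with census {`D`, `B`, `I`, `x`, `hx`, `hH` (closed), `hI`, `Δ_H` tfg, F-0001 shape at `H` | F-0001/F-0007 BY NAME on packagings} — `hY` trivial,
  `hΔ` DERIVED; the canonical closed-family record `MergeInputs.ofGroupDataModuli D B (m2OfClosed …) hTFG` (★ p503701 / abc-iut-L5-t3 ★ p500005)
  is the instance `ex32vi_abc_frobeniusBadAt_closedFamily_of_coinvariantRank`;
* AGREEMENT at the stand-in BY NAME: `ex32vi_abc_frobeniusBadAt_standInFamily_of_regime` — the closed-`H` theorem at the family
  `badPairAtArrow hA` (closed: ★ p501395 `isClosed_badPairAtArrow_H`; `Δ` tfg: the theorem above) RECOVERS the hypothesis shape of ★ p503880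
  `ex32vi_abc_frobeniusBadAt_standIn_of_regime` (F-0001 BY NAME on the packagings of the stand-in, no tfg input) for EVERY merge record over
  the stand-in family whose (m2) at `x` is `m2StandIn` (★ p503880 treated the named record `mergeInputsStandIn`).
LABEL «[MODEL datum at a closed family: m2 aug genuine & canonical / `Ÿ` degenerate; m1 formal; m4 genuine]»; a regime instance of OUR predicate
at OUR object; [AbsAnab]/[AbsTopI]/[SemiAnbd] refereed and undisputed; no Ex. 3.2 (i) token; no instance, no notation, no `sorry`;
typed ≠ inhabited ≠ proved; nothing here asserts abc proved or refuted.
-/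

noncomputable section

namespace Literature.IUT.HodgeTheaters

open Literature.AnabelianGeometry.AbsoluteAnabelian Literature.AnabelianGeometry.SemiGraphs
  Literature.NumberTheory.NumberFields _root_.IsDedekindDomain _root_.NumberField Topology

/-! ### Plumbing: transport of characteristic subgroups and of topological finite generation along an isomorphism -/

/-- Transport of characteristic subgroups along `e : A ≃ₜ* B` (conjugate an automorphism `φ` of `B` back to `e⁻¹ ∘ φ ∘ e`). [folklore] -/
private theorem subgroup_map_equiv_transport' {A B : Type*} [Group A] [Group B] [TopologicalSpace A] [TopologicalSpace B]
    (e : A ≃ₜ* B) (N : Subgroup A) (hN : ∀ ψ : A ≃ₜ* A, N.map ψ.toMulEquiv.toMonoidHom = N) (φ : B ≃ₜ* B) :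
    (N.map e.toMulEquiv.toMonoidHom).map φ.toMulEquiv.toMonoidHom = N.map e.toMulEquiv.toMonoidHom := by
  have h := hN (e.trans (φ.trans e.symm))
  apply_fun Subgroup.map e.toMulEquiv.toMonoidHom at h
  rw [Subgroup.map_map] at h
  rw [Subgroup.map_map]
  convert h using 2
  refine MonoidHom.ext fun a => ?_
  change φ (e a) = e ((e.trans (φ.trans e.symm)) a)
  simp

/-- `e(N)` is topologically finitely generated when `N` is (`e : A ≃ₜ* B`; the restriction `N ↠ e(N)` is a continuous surjection). [folklore] -/
private theorem tfg_map_equiv {A B : Type*} [Group A] [Group B] [TopologicalSpace A] [TopologicalSpace B]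
    [IsTopologicalGroup A] [IsTopologicalGroup B] (e : A ≃ₜ* B) (N : Subgroup A) (hN : IsTopologicallyFinitelyGenerated N) :
    IsTopologicallyFinitelyGenerated (N.map e.toMulEquiv.toMonoidHom) := by
  let f : N →ₜ* (N.map e.toMulEquiv.toMonoidHom) :=
    { toMonoidHom := (e.toMulEquiv.toMonoidHom.comp N.subtype).codRestrict _ fun n => Subgroup.mem_map_of_mem _ n.2
      continuous_toFun := ((map_continuous e).comp continuous_subtype_val).subtype_mk _ }
  refine hN.of_surjective f ?_
  rintro ⟨_, n, hn, rfl⟩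
  exact ⟨⟨n, hn⟩, rfl⟩

/-- `N` is topologically finitely generated when `e(N)` is (apply the previous lemma to `e⁻¹`). [folklore] -/
private theorem tfg_of_map_equiv {A B : Type*} [Group A] [Group B] [TopologicalSpace A] [TopologicalSpace B]
    [IsTopologicalGroup A] [IsTopologicalGroup B] (e : A ≃ₜ* B) (N : Subgroup A)
    (hN : IsTopologicallyFinitelyGenerated (N.map e.toMulEquiv.toMonoidHom)) : IsTopologicallyFinitelyGenerated N := by
  have hcomp : e.symm.toMulEquiv.toMonoidHom.comp e.toMulEquiv.toMonoidHom = MonoidHom.id A :=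
    MonoidHom.ext fun a => e.symm_apply_apply a
  have h := tfg_map_equiv e.symm _ hN
  rw [Subgroup.map_map, hcomp, Subgroup.map_id] at h
  exact h

variable {F K Fbar : Type} [Field F] [NumberField F] [Field K] [NumberField K] [Algebra F K]
  [Field Fbar] [Algebra F Fbar] [Algebra K Fbar] {E : WeierstrassCurve F}
  [E.IsElliptic] {l : ℕ} {Pb : BadPlacePredicates K} (D : InitialThetaData F K Fbar E l Pb)

namespace InitialThetaData

/-! ### §1 `hΔ` at `m2OfClosed B x hx hH` — packaging, F-0007 by name, F-0001 regime -/

section Closed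

variable (B : ∀ v, v ∈ D.indexCopyBad → D.BadPairAt v) (x : D.IndexCopy) (hx : x ∈ D.indexCopyBad)
  (hH : IsClosed ((B x hx).H : Set D.PiC))

/-- **`hY` at `m2OfClosed` is TRIVIAL**: with `Π_Ÿ := Π_v̲` (`m2OfClosed_Y`) every bicontinuous automorphism carries `Π_Ÿ` onto a conjugate of
itself (conjugator `1`). ([IUTchI] Ex 3.2 (ii) p.70) [claim: Mochizuki2012, status: disputed] -/
theorem hY_m2OfClosed (φ : ↥(B x hx).H ≃ₜ* ↥(B x hx).H) :
    ∃ c : ↥(B x hx).H, ∀ g : ↥(B x hx).H, g ∈ (D.m2OfClosed B x hx hH).Y ↔ c⁻¹ * φ g * c ∈ (D.m2OfClosed B x hx hH).Y :=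
  ⟨1, fun g => by simp only [m2OfClosed_Y, OpenSubgroup.mem_top]⟩

/-- **Transport of `hΔ` to `m2OfClosed` from [AbsAnab] Lemma 1.3.8 BY NAME** (F-0007 `PreservesGeom`) on ANY packaging `Ev` of
`H ↠ Gal(K̄_v̲/K_v̲)` as an abc-iut-L4 extension (`e : Π_{Ev} ≅ H`, `e(Δ_{Ev}) = Ker(aug)`). [cite: MochizukiAbsAnab2004, Lemma 1.3.8 p.18] -/
theorem forall_map_ker_m2OfClosed_aug_of_preservesGeom (Ev : FundamentalExtension.{0}) (e : Ev.arith ≃ₜ* ↥(B x hx).H)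
    (he : Ev.geom.map e.toMulEquiv.toMonoidHom = (D.m2OfClosed B x hx hH).aug.ker)
    (hgeom : ∀ α : Ev.arith ≃ₜ* Ev.arith, FundamentalExtension.PreservesGeom α)
    (φ : ↥(B x hx).H ≃ₜ* ↥(B x hx).H) :
    (D.m2OfClosed B x hx hH).aug.ker.map φ.toMulEquiv.toMonoidHom = (D.m2OfClosed B x hx hH).aug.ker := by
  rw [← he]
  exact subgroup_map_equiv_transport' e Ev.geom hgeom φ

/-- **NON-VACUITY of the packaging at a CLOSED bad pair, WITH MLF BASE DATA**: `H` closed in the profinite `Π_{C_F}` is profinite, and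
`H ↠ Gal(K̄_v̲/K_v̲)` (the canonical `augOfOver` of ★ p503701: continuous, surjective) IS an extension `1 → Δ → Π → G → 1` in abc-iut-L4's sense with
`MLFBase` `(p_v̲, K_v̲ := RescaledCompletion K p_v̲ w_v̲, galIso := id)` — `GalAt x = Gal(K̄_v̲/K_v̲)` being Mathlib's absolute Galois group on the
nose; `e = id`, `e(Δ_{Ev}) = Ker(aug)`. [cite: MochizukiAbsAnab2004, §1.3 p.18] -/
theorem exists_fundamentalExtension_m2OfClosed :
    ∃ (Ev : FundamentalExtension.{0}) (_ : Ev.MLFBase) (e : Ev.arith ≃ₜ* ↥(B x hx).H),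
      Ev.geom.map e.toMulEquiv.toMonoidHom = (D.m2OfClosed B x hx hH).aug.ker := by
  haveI := D.fact_primeAt_prime x (D.not_mem_arc_of_mem_bad hx)
  haveI : CompactSpace ↥(B x hx).H := isCompact_iff_compactSpace.mp hH.isCompact
  haveI := GaloisValDatum.finiteDimensional_rescaledCompletion K (D.primeAt x (D.not_mem_arc_of_mem_bad hx))
    (D.specAt x (D.not_mem_arc_of_mem_bad hx)) (D.primeAt_mem x (D.not_mem_arc_of_mem_bad hx))
  haveI : CharZero (RescaledCompletion K (D.primeAt x (D.not_mem_arc_of_mem_bad hx))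
      (D.specAt x (D.not_mem_arc_of_mem_bad hx)) (D.primeAt_mem x (D.not_mem_arc_of_mem_bad hx))) :=
    charZero_of_injective_algebraMap (algebraMap ℚ_[D.primeAt x (D.not_mem_arc_of_mem_bad hx)] _).injective
  let Ev : FundamentalExtension.{0} :=
    { arith := ProfiniteGrp.of ↥(B x hx).H
      gal := absoluteGaloisGrp (RescaledCompletion K (D.primeAt x (D.not_mem_arc_of_mem_bad hx))
        (D.specAt x (D.not_mem_arc_of_mem_bad hx)) (D.primeAt_mem x (D.not_mem_arc_of_mem_bad hx)))
      aug := ⟨(D.m2OfClosed B x hx hH).aug, (D.m2OfClosed B x hx hH).continuous_aug⟩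
      aug_surjective := (D.m2OfClosed B x hx hH).surjective_aug }
  let Bm : Ev.MLFBase :=
    { p := D.primeAt x (D.not_mem_arc_of_mem_bad hx)
      K := RescaledCompletion K (D.primeAt x (D.not_mem_arc_of_mem_bad hx)) (D.specAt x (D.not_mem_arc_of_mem_bad hx))
        (D.primeAt_mem x (D.not_mem_arc_of_mem_bad hx))
      galIso := ContinuousMulEquiv.refl _ }
  exact ⟨Ev, Bm, ContinuousMulEquiv.refl _, Subgroup.map_id _⟩

/-- **`hΔ` at `m2OfClosed` DERIVED — F-0007 at `H` from «`Δ_H` tfg» + F-0001 IN UNFOLDED SHAPE at `H`.**  If `Δ_H := Ker(H ↠ Gal(K̄_v̲/K_v̲))` is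
topologically finitely generated and for every open subgroup `Q ⊆ H` the number `δ¹_l(Q) − δ¹_l(aug Q)` does not depend on the prime `l` (F-0001
`CoinvariantRankConstant`; print: [AbsTopI] Thm 2.6 (ii) on open subgroups), then every bicontinuous automorphism of the CLOSED local group `H`
carries `Δ_H` onto itself ([AbsTopI] Thm 2.6 (v), kernel theorem `preservesGeom_of_coinvariantRankConstant` at the packaging `(H, Gal(K̄_v̲/K_v̲), aug)`).
[cite: MochizukiAbsTopI2012, Thm 2.6 (v) p.22] -/
theorem forall_map_ker_m2OfClosed_aug_of_coinvariantRank
    (hΔtfg : IsTopologicallyFinitelyGenerated (D.m2OfClosed B x hx hH).aug.ker)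
    (hc : ∀ Q : Subgroup ↥(B x hx).H, IsOpen (Q : Set ↥(B x hx).H) →
      ∀ (l₁ l₂ : ℕ) [Fact l₁.Prime] [Fact l₂.Prime],
        freeProlRank Q l₁ - freeProlRank (Q.map (D.m2OfClosed B x hx hH).aug) l₁ =
          freeProlRank Q l₂ - freeProlRank (Q.map (D.m2OfClosed B x hx hH).aug) l₂)
    (φ : ↥(B x hx).H ≃ₜ* ↥(B x hx).H) :
    (D.m2OfClosed B x hx hH).aug.ker.map φ.toMulEquiv.toMonoidHom = (D.m2OfClosed B x hx hH).aug.ker := by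
  haveI := D.fact_primeAt_prime x (D.not_mem_arc_of_mem_bad hx)
  haveI : CompactSpace ↥(B x hx).H := isCompact_iff_compactSpace.mp hH.isCompact
  haveI := GaloisValDatum.finiteDimensional_rescaledCompletion K (D.primeAt x (D.not_mem_arc_of_mem_bad hx))
    (D.specAt x (D.not_mem_arc_of_mem_bad hx)) (D.primeAt_mem x (D.not_mem_arc_of_mem_bad hx))
  haveI : CharZero (RescaledCompletion K (D.primeAt x (D.not_mem_arc_of_mem_bad hx))
      (D.specAt x (D.not_mem_arc_of_mem_bad hx)) (D.primeAt_mem x (D.not_mem_arc_of_mem_bad hx))) :=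
    charZero_of_injective_algebraMap (algebraMap ℚ_[D.primeAt x (D.not_mem_arc_of_mem_bad hx)] _).injective
  let Ev : FundamentalExtension.{0} :=
    { arith := ProfiniteGrp.of ↥(B x hx).H
      gal := absoluteGaloisGrp (RescaledCompletion K (D.primeAt x (D.not_mem_arc_of_mem_bad hx))
        (D.specAt x (D.not_mem_arc_of_mem_bad hx)) (D.primeAt_mem x (D.not_mem_arc_of_mem_bad hx)))
      aug := ⟨(D.m2OfClosed B x hx hH).aug, (D.m2OfClosed B x hx hH).continuous_aug⟩
      aug_surjective := (D.m2OfClosed B x hx hH).surjective_aug }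
  let Bm : Ev.MLFBase :=
    { p := D.primeAt x (D.not_mem_arc_of_mem_bad hx)
      K := RescaledCompletion K (D.primeAt x (D.not_mem_arc_of_mem_bad hx)) (D.specAt x (D.not_mem_arc_of_mem_bad hx))
        (D.primeAt_mem x (D.not_mem_arc_of_mem_bad hx))
      galIso := ContinuousMulEquiv.refl _ }
  have htfg : IsTopologicallyFinitelyGenerated Ev.geom := hΔtfg
  have hcE : Ev.CoinvariantRankConstant := fun Q hQ l₁ l₂ _ _ => hc Q hQ l₁ l₂
  exact FundamentalExtension.preservesGeom_of_coinvariantRankConstant Bm Bm htfg hcE htfg hcE φ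

/-- **`hΔ` at `m2OfClosed` from [AbsTopI] Thm 2.6 (v) in the regime `CoinvariantRankConstant` BY NAME on packagings**: if every packaging of
`H ↠ Gal(K̄_v̲/K_v̲)` with MLF base data and `e(Δ_{Ev}) = Δ_H` has `Δ_{Ev}` tfg and `CoinvariantRankConstant` (F-0001), then every bicontinuous
automorphism of `H` preserves `Δ_H` (packaging by `exists_fundamentalExtension_m2OfClosed`). [cite: MochizukiAbsTopI2012, Thm 2.6 (v) p.22] -/
theorem forall_map_ker_m2OfClosed_aug_of_regime
    (hreg : ∀ (Ev : FundamentalExtension.{0}) (_ : Ev.MLFBase) (e : Ev.arith ≃ₜ* ↥(B x hx).H),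
      Ev.geom.map e.toMulEquiv.toMonoidHom = (D.m2OfClosed B x hx hH).aug.ker →
        IsTopologicallyFinitelyGenerated Ev.geom ∧ Ev.CoinvariantRankConstant)
    (φ : ↥(B x hx).H ≃ₜ* ↥(B x hx).H) :
    (D.m2OfClosed B x hx hH).aug.ker.map φ.toMulEquiv.toMonoidHom = (D.m2OfClosed B x hx hH).aug.ker := by
  obtain ⟨Ev, Bm, e, he⟩ := D.exists_fundamentalExtension_m2OfClosed B x hx hH
  obtain ⟨htfg, hc⟩ := hreg Ev Bm e he
  exact D.forall_map_ker_m2OfClosed_aug_of_preservesGeom B x hx hH Ev e he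
    (fun α => FundamentalExtension.preservesGeom_of_coinvariantRankConstant Bm Bm htfg hc htfg hc α) φ

/-- **`hΔ` at `m2OfClosed` in the profinite-completion currency** of `BadLocalGroupDatumDeltaCharacteristic` ([SemiAnbd] §6 reduction): the
Thm 2.6 (v) regime BY NAME on the compatible MLF completion packages of `H` (which EXIST, `BadLocalGroupDatum.exists_completion_package`).
[cite: MochizukiAbsTopI2012, Thm 2.6 (v) p.22] -/
theorem forall_map_ker_m2OfClosed_aug_of_completionRegime
    (hreg : ∀ (Ev : FundamentalExtension.{0}) (_ : Ev.MLFBase) (ι : ↥(B x hx).H →ₜ* Ev.arith)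
      (g : D.GalAt x (D.not_mem_arc_of_mem_bad hx) →* Ev.gal),
      IsProfiniteCompletion ι → Function.Injective g → (∀ h, Ev.aug (ι h) = g ((D.m2OfClosed B x hx hH).aug h)) →
        IsTopologicallyFinitelyGenerated Ev.geom ∧ Ev.CoinvariantRankConstant)
    (φ : ↥(B x hx).H ≃ₜ* ↥(B x hx).H) :
    (D.m2OfClosed B x hx hH).aug.ker.map φ.toMulEquiv.toMonoidHom = (D.m2OfClosed B x hx hH).aug.ker := by
  haveI := D.fact_primeAt_prime x (D.not_mem_arc_of_mem_bad hx)
  haveI := GaloisValDatum.finiteDimensional_rescaledCompletion K (D.primeAt x (D.not_mem_arc_of_mem_bad hx))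
    (D.specAt x (D.not_mem_arc_of_mem_bad hx)) (D.primeAt_mem x (D.not_mem_arc_of_mem_bad hx))
  exact BadLocalGroupDatum.forall_map_ker_aug_of_regime
    (k := RescaledCompletion K (D.primeAt x (D.not_mem_arc_of_mem_bad hx)) (D.specAt x (D.not_mem_arc_of_mem_bad hx))
      (D.primeAt_mem x (D.not_mem_arc_of_mem_bad hx)))
    (D.primeAt x (D.not_mem_arc_of_mem_bad hx)) (D.m2OfClosed B x hx hH) hreg φ

end Closed

/-! ### «`Δ_H` tfg» is a THEOREM at the stand-in family (F-0240 + `hA` + `CG`) -/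

section StandInTFG

variable (hA : D.geom.pe.ArrowCoveringClaims) (CG : D.geom.pe.CuspGalois)

/-- **`Δ_v̲` at the stand-in is topologically finitely generated** under F-0240 (`hTFG`): `Ker((m2StandIn).aug) = standInEquiv(Ker(augLoc))`
(★ p503880 `ker_m2StandIn_aug_eq_map`) and `Ker(augLoc) ≅ Π_{X̲→_K} ∩ Δ_C` is open in the tfg `Δ_C` (abc-iut-L5-t16
`isTopologicallyFinitelyGenerated_ker_augLoc`, `hX` free via `isOpen_PiXarrow_of_cuspGalois`). [cite: MochizukiAbsTopI2012, Prop 2.2 p.18] -/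
theorem isTopologicallyFinitelyGenerated_ker_m2StandIn_aug (hTFG : D.geom.extF.GeomTFG) (x : D.IndexCopy) (hx : x ∉ D.indexCopyArc)
    [Fact (D.primeAt x hx).Prime] : IsTopologicallyFinitelyGenerated (D.m2StandIn hA CG hTFG x hx).aug.ker := by
  haveI := D.isScalarTower
  rw [D.ker_m2StandIn_aug_eq_map hA CG hTFG x hx]
  exact tfg_map_equiv _ _
    (D.isTopologicallyFinitelyGenerated_ker_augLoc D.PiXarrow (D.rhoAt x hx) hTFG (D.isOpen_PiXarrow_of_cuspGalois hA hTFG CG))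

include CG in
/-- **«`Δ_H` tfg» at the stand-in family read through `m2OfClosed`** (agreement ★ p503701 `m2OfClosed_badPairAtArrow_eq_m2StandIn` BY NAME).
[cite: MochizukiAbsTopI2012, Prop 2.2 p.18] -/
theorem isTopologicallyFinitelyGenerated_ker_m2OfClosed_aug_badPairAtArrow (hTFG : D.geom.extF.GeomTFG) (x : D.IndexCopy)
    (hx : x ∈ D.indexCopyBad) [Fact (D.primeAt x (D.not_mem_arc_of_mem_bad hx)).Prime]
    (hH : IsClosed ((D.badPairAtArrow hA x).H : Set D.PiC)) :
    IsTopologicallyFinitelyGenerated (D.m2OfClosed (fun v _ => D.badPairAtArrow hA v) x hx hH).aug.ker := by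
  rw [D.m2OfClosed_badPairAtArrow_eq_m2StandIn hA CG x hx hTFG hH]
  exact D.isTopologicallyFinitelyGenerated_ker_m2StandIn_aug hA CG hTFG x (D.not_mem_arc_of_mem_bad hx)

end StandInTFG

/-! ### §2 [IUTchI] Example 3.2 (vi)(a)(b)(c) at EVERY closed bad-pair family -/

section Cone

variable (B : ∀ v, v ∈ D.indexCopyBad → D.BadPairAt v) (x : D.IndexCopy) (hx : x ∈ D.indexCopyBad)
  (hH : IsClosed ((B x hx).H : Set D.PiC)) (I : D.MergeInputs B) (hI : I.m2 x hx = D.m2OfClosed B x hx hH)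

include hI in
/-- **[IUTchI] Ex. 3.2 (vi)(a)(b)(c) AT A CLOSED BAD PAIR, `hΔ` DERIVED — modulo «`Δ_H` tfg» and F-0001 `CoinvariantRankConstant` IN UNFOLDED SHAPE
at `H` ONLY** (for every merge record `I` whose (m2) at `x` is `m2OfClosed B x hx hH`): at `frobeniusBadAt B I x hx`, (a) `𝒟⊢ ⊆ 𝒟` from `𝒟`,
(b) `𝒟^Θ` from `𝒟`, (c) bases from `𝒞⊢`/`𝒞^Θ` — ★ p497246 `ex32vi_abc_frobeniusBadAt_of_isClosed` with `hH` the closedness, `hY` := `hY_m2OfClosed`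
(trivial) and `hΔ` := `forall_map_ker_m2OfClosed_aug_of_coinvariantRank`. ([IUTchI] Ex 3.2 (vi) p.73) [claim: Mochizuki2012, status: disputed] -/
theorem ex32vi_abc_frobeniusBadAt_of_isClosed_of_coinvariantRank [Fact (D.primeAt x (D.not_mem_arc_of_mem_bad hx)).Prime]
    (hΔtfg : IsTopologicallyFinitelyGenerated (D.m2OfClosed B x hx hH).aug.ker)
    (hc : ∀ Q : Subgroup ↥(B x hx).H, IsOpen (Q : Set ↥(B x hx).H) →
      ∀ (l₁ l₂ : ℕ) [Fact l₁.Prime] [Fact l₂.Prime],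
        freeProlRank Q l₁ - freeProlRank (Q.map (D.m2OfClosed B x hx hH).aug) l₁ =
          freeProlRank Q l₂ - freeProlRank (Q.map (D.m2OfClosed B x hx hH).aug) l₂) :
    (D.frobeniusBadAt B I x hx).DdashFromD ∧ (D.frobeniusBadAt B I x hx).DThetaFromD ∧ (D.frobeniusBadAt B I x hx).BasesFromC := by
  refine D.ex32vi_abc_frobeniusBadAt_of_isClosed B I x hx hH (fun φ => ?_) (fun φ => ?_)
  · rw [hI]
    exact D.forall_map_ker_m2OfClosed_aug_of_coinvariantRank B x hx hH hΔtfg hc φ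
  · rw [hI]
    exact D.hY_m2OfClosed B x hx hH φ

include hI in
/-- **[IUTchI] Ex. 3.2 (vi)(a)(b)(c) at a closed bad pair modulo the [AbsTopI] Thm 2.6 (v) regime BY NAME on every packaging of
`H ↠ Gal(K̄_v̲/K_v̲)` with MLF base data** (`Δ` tfg + F-0001; packagings EXIST). ([IUTchI] Ex 3.2 (vi) p.73) [claim: Mochizuki2012, status: disputed] -/
theorem ex32vi_abc_frobeniusBadAt_of_isClosed_of_regime [Fact (D.primeAt x (D.not_mem_arc_of_mem_bad hx)).Prime]
    (hreg : ∀ (Ev : FundamentalExtension.{0}) (_ : Ev.MLFBase) (e : Ev.arith ≃ₜ* ↥(B x hx).H),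
      Ev.geom.map e.toMulEquiv.toMonoidHom = (D.m2OfClosed B x hx hH).aug.ker →
        IsTopologicallyFinitelyGenerated Ev.geom ∧ Ev.CoinvariantRankConstant) :
    (D.frobeniusBadAt B I x hx).DdashFromD ∧ (D.frobeniusBadAt B I x hx).DThetaFromD ∧ (D.frobeniusBadAt B I x hx).BasesFromC := by
  refine D.ex32vi_abc_frobeniusBadAt_of_isClosed B I x hx hH (fun φ => ?_) (fun φ => ?_)
  · rw [hI]
    exact D.forall_map_ker_m2OfClosed_aug_of_regime B x hx hH hreg φ
  · rw [hI]
    exact D.hY_m2OfClosed B x hx hH φ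

include hI in
/-- **[IUTchI] Ex. 3.2 (vi)(a)(b)(c) at a closed bad pair modulo [AbsAnab] Lemma 1.3.8 BY NAME** (F-0007 `PreservesGeom` for every
self-isomorphism of ONE packaging `Ev` of `H ↠ Gal(K̄_v̲/K_v̲)`, `e(Δ_{Ev}) = Δ_H`). ([IUTchI] Ex 3.2 (vi) p.73) [claim: Mochizuki2012, status: disputed] -/
theorem ex32vi_abc_frobeniusBadAt_of_isClosed_of_preservesGeom [Fact (D.primeAt x (D.not_mem_arc_of_mem_bad hx)).Prime]
    (Ev : FundamentalExtension.{0}) (e : Ev.arith ≃ₜ* ↥(B x hx).H)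
    (he : Ev.geom.map e.toMulEquiv.toMonoidHom = (D.m2OfClosed B x hx hH).aug.ker)
    (hgeom : ∀ α : Ev.arith ≃ₜ* Ev.arith, FundamentalExtension.PreservesGeom α) :
    (D.frobeniusBadAt B I x hx).DdashFromD ∧ (D.frobeniusBadAt B I x hx).DThetaFromD ∧ (D.frobeniusBadAt B I x hx).BasesFromC := by
  refine D.ex32vi_abc_frobeniusBadAt_of_isClosed B I x hx hH (fun φ => ?_) (fun φ => ?_)
  · rw [hI]
    exact D.forall_map_ker_m2OfClosed_aug_of_preservesGeom B x hx hH Ev e he hgeom φ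
  · rw [hI]
    exact D.hY_m2OfClosed B x hx hH φ

end Cone

section ClosedFamily

variable (B : ∀ v, v ∈ D.indexCopyBad → D.BadPairAt v) (hH : ∀ v (hv : v ∈ D.indexCopyBad), IsClosed ((B v hv).H : Set D.PiC))
  (x : D.IndexCopy) (hx : x ∈ D.indexCopyBad)

/-- **(vi)(a)(b)(c) at the CANONICAL merge record of a CLOSED bad-pair family** — `MergeInputs.ofGroupDataModuli D B (m2OfClosed …) hTFG`
((m2) ★ p503701, (m1) abc-iut-L5-t3's sum model ★ p500005, (m4) `𝒞⊩_mod`, F-0240) — modulo «`Δ_H` tfg» + F-0001 unfolded at `H`; its (m2) at `x`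
IS `m2OfClosed` (`rfl`). Census: {`D`, `B`, `hH`, `hTFG` (F-0240), `x`, `hx`, `Δ_H` tfg, F-0001 shape}. ([IUTchI] Ex 3.2 (vi) p.73) [claim: Mochizuki2012, status: disputed] -/
theorem ex32vi_abc_frobeniusBadAt_closedFamily_of_coinvariantRank (hTFG : D.geom.extF.GeomTFG)
    [Fact (D.primeAt x (D.not_mem_arc_of_mem_bad hx)).Prime]
    (hΔtfg : IsTopologicallyFinitelyGenerated (D.m2OfClosed B x hx (hH x hx)).aug.ker)
    (hc : ∀ Q : Subgroup ↥(B x hx).H, IsOpen (Q : Set ↥(B x hx).H) →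
      ∀ (l₁ l₂ : ℕ) [Fact l₁.Prime] [Fact l₂.Prime],
        freeProlRank Q l₁ - freeProlRank (Q.map (D.m2OfClosed B x hx (hH x hx)).aug) l₁ =
          freeProlRank Q l₂ - freeProlRank (Q.map (D.m2OfClosed B x hx (hH x hx)).aug) l₂) :
    (D.frobeniusBadAt B (MergeInputs.ofGroupDataModuli D B (fun v hv => D.m2OfClosed B v hv (hH v hv)) hTFG) x hx).DdashFromD ∧
      (D.frobeniusBadAt B (MergeInputs.ofGroupDataModuli D B (fun v hv => D.m2OfClosed B v hv (hH v hv)) hTFG) x hx).DThetaFromD ∧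
      (D.frobeniusBadAt B (MergeInputs.ofGroupDataModuli D B (fun v hv => D.m2OfClosed B v hv (hH v hv)) hTFG) x hx).BasesFromC :=
  D.ex32vi_abc_frobeniusBadAt_of_isClosed_of_coinvariantRank B x hx (hH x hx) _ rfl hΔtfg hc

end ClosedFamily

/-! ### §3 AGREEMENT at the stand-in: the closed-`H` route recovers ★ p503880's stand-in theorem, same hypothesis shape -/

section Agreement

variable (hA : D.geom.pe.ArrowCoveringClaims) (CG : D.geom.pe.CuspGalois) (x : D.IndexCopy) (hx : x ∈ D.indexCopyBad)

include CG in
/-- **AGREEMENT BY NAME, for EVERY merge record over the stand-in family**: at `B := badPairAtArrow hA` — closed (★ p501395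
`isClosed_badPairAtArrow_H`), `Δ` tfg (THEOREM `isTopologicallyFinitelyGenerated_ker_m2StandIn_aug`), `m2OfClosed … = m2StandIn …` (★ p503701
`m2OfClosed_badPairAtArrow_eq_m2StandIn`) — the closed-`H` theorem `ex32vi_abc_frobeniusBadAt_of_isClosed_of_regime` yields (a)(b)(c) at
`frobeniusBadAt _ I x hx` for EVERY record `I` whose (m2) at `x` is `m2StandIn` (e.g. `mergeInputsStandIn`, ★ p501395, by `mergeInputsStandIn_m2`),
from F-0001 BY NAME on the packagings of the stand-in ALONE (no tfg input) — the hypothesis shape of ★ p503880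
`ex32vi_abc_frobeniusBadAt_standIn_of_regime`, now for every such `I`. ([IUTchI] Ex 3.2 (vi) p.73) [claim: Mochizuki2012, status: disputed] -/
theorem ex32vi_abc_frobeniusBadAt_standInFamily_of_regime (hTFG : D.geom.extF.GeomTFG)
    [Fact (D.primeAt x (D.not_mem_arc_of_mem_bad hx)).Prime] (I : D.MergeInputs fun v _ => D.badPairAtArrow hA v)
    (hI : I.m2 x hx = D.m2StandIn hA CG hTFG x (D.not_mem_arc_of_mem_bad hx))
    (hreg : ∀ (Ev : FundamentalExtension.{0}) (_ : Ev.MLFBase) (e : Ev.arith ≃ₜ* ↥(D.badPairAtArrow hA x).H),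
      Ev.geom.map e.toMulEquiv.toMonoidHom =
          (D.m2StandIn hA CG hTFG x (D.not_mem_arc_of_mem_bad hx)).aug.ker → Ev.CoinvariantRankConstant) :
    (D.frobeniusBadAt _ I x hx).DdashFromD ∧ (D.frobeniusBadAt _ I x hx).DThetaFromD ∧ (D.frobeniusBadAt _ I x hx).BasesFromC := by
  have hH : IsClosed ((D.badPairAtArrow hA x).H : Set D.PiC) := D.isClosed_badPairAtArrow_H hA CG hTFG x hx
  have hagree := D.m2OfClosed_badPairAtArrow_eq_m2StandIn hA CG x hx hTFG hH
  refine D.ex32vi_abc_frobeniusBadAt_of_isClosed_of_regime (fun v _ => D.badPairAtArrow hA v) x hx hH I (hI.trans hagree.symm)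
    fun Ev Bm e he => ?_
  rw [hagree] at he
  refine ⟨?_, hreg Ev Bm e he⟩
  -- `Δ_{Ev}` is tfg: `e(Δ_{Ev}) = Δ_v̲` is tfg at the stand-in (F-0240), transport back along `e`
  exact tfg_of_map_equiv e Ev.geom (he ▸ D.isTopologicallyFinitelyGenerated_ker_m2StandIn_aug hA CG hTFG x _)

end Agreement

end InitialThetaData

end Literature.IUT.HodgeTheaters

end
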